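import Literature.Probability.LatticeModels.ScaleFrameRatioSurgery
import Literature.Analysis.Convexity.KestenRatioScheme
import HarnessLib

/-!
# Kesten's ratio forgetting along a scale frame (proved, modulo Kesten's Lemma (23))

Topic `Literature/Probability/LatticeModels` (trunk `StatMech`, family `crit-ising`). H. Kesten's
ratio-limit theorem (PTRF 73 (1986), Thm. 3 and §2, eqs. (16)–(25)) in the planarity-free form of
D. Basu, A. Sapozhnikov (ECP 22 (2017), §2), on an abstract `ScaleFrame`: along the levels
`a_l = aM^{l(m+17+g)}`, `l = 0, …, L`, the data of level `l` are the explored sets of the block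
`(a_l, a_lM^m)` with their rims wired OFF the inside, and `u^l_y(d) = φ(Fd_l(d) ∩ InP_y(d)) / φ(Fd_l(d))`
is the conditional probability, given the datum `d = (U, R)`, that the anchor `y` is joined inside
`U` to a vertex carrying an open edge to the rim `R`. For two anchors `x, x'` joined by a walk of the
frame deep inside `inSet a`, the double ratio `[u^L_x(d) / u^L_{x'}(d)] / [u^L_x(d₂) / u^L_{x'}(d₂)]`
is at most `Q L` for every supersolution `Q` of the Hopf–Doeblin recursion with cross-ratio constant
`K = q⁸/c²⁰` and junk `ε = (1-c)^{⌊m/2⌋}` (`ScaleFrame.insideRatio_osc_le_of_key`), GIVEN Kesten's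
Lemma (23) for the chain kernel in the exact form of the registered statement
`ScaleFrame.kernel_crossRatio_le` (taken as a hypothesis).

Proof: the abstract scheme `kesten_multilevel_osc_le` (`KestenRatioScheme.lean`) with the kernels
`M_l(C, D) = N_l(C, D) / φ(Fd_{l+1}(C))` of `ScaleFrameRatioChain.lean`, the index sets
`s_l = {D | u^l_x(D) > 0, and D receives a positive kernel entry if l < L}`, the two-sided squeeze of
`ScaleFrame.chainLevel_squeeze` (chain identity plus junk bound), the cross-ratio bound
`ScaleFrame.kernel_crossRatio_le_of_key`, and positivity/nonemptiness from the configuration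
surgeries `ScaleFrame.insidePiece_pos_of_walk` (`u^l_{x'} > 0 ⇔ u^l_x > 0`) and
`ScaleFrame.exists_kernel_pos`. Everything is proved; no definitions.

## References
* [Kesten1986] H. Kesten, Probab. Theory Related Fields 73 (1986) 369–394, §2, eqs. (16)–(25),
  Lemma (23), Thm. 3.
* [BasuSapozhnikov2017ECP] D. Basu, A. Sapozhnikov, ECP 22 (2017) no. 26, §2.
* E. Hopf, J. Math. Mech. 12 (1963) 683–692, Thm. 1.
-/

open MeasureTheory Finset SimpleGraph
open Literature.Probability.Percolation (BondConfig openConnIn openCrossing explEvent)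

universe u

namespace Literature.Probability.LatticeModels

/-- **(ABS-A, modulo Lemma (23)) Kesten's ratio forgetting along a scale frame.** Given Kesten's
Lemma (23) for the chain kernel (the statement of `ScaleFrame.kernel_crossRatio_le`, as hypothesis):
at the top level `L` the ratio of the two anchors' conditional inside probabilities oscillates over
the data by at most any supersolution `Q L` of the Hopf–Doeblin recursion with cross-ratio constant
`K = q⁸/c²⁰` and junk `ε = (1-c)^{⌊m/2⌋}` (Off family: rim wired inside `U ∖ inSet aL`).
[cite: Kesten1986, §2 eqs. (22)–(25) and Thm. 3] -/
theorem ScaleFrame.insideRatio_osc_le_of_key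
    (hKEY : ∀ {V : Type u} [Fintype V] [DecidableEq V] (F : ScaleFrame V) {p q c a M : ℝ} {m g : ℕ},
      p ∈ Set.Ico (0 : ℝ) 1 → 1 ≤ q → 0 < c → c ≤ 1 → 0 < a → 4 ≤ M → 1 ≤ m → 1 ≤ g →
      a * M ^ (m + 16 + g) ≤ F.Rmax → F.η ≤ a →
      F.LadderRSWb p q c a M (m + 16 + g) 13 →
    ∀ (U' R' U'' R'' : Set V),
      (∀ v ∈ U', v ∈ F.good ∧ F.rad v < a * M ^ m) →
      (∀ v ∈ R', v ∈ F.good ∧ F.rad v < a * M ^ m + F.η) →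
      (∀ v ∈ U'', v ∈ F.good ∧ F.rad v < a * M ^ m) →
      (∀ v ∈ R'', v ∈ F.good ∧ F.rad v < a * M ^ m + F.η) →
    ∀ (Fo Fo' : Set (BondConfig V)) (Wo Wo' R Rq : Set V),
      (∀ ω₁ ω₂ : BondConfig V, (∀ e ∈ F.E,
        (∀ x ∈ e, x ∈ F.outSet (a * M ^ (m + 16)) (a * M ^ (m + 16 + g))) → (e ∈ ω₁ ↔ e ∈ ω₂)) →
          (ω₁ ∈ Fo ↔ ω₂ ∈ Fo)) →
      (∀ ω₁ ω₂ : BondConfig V, (∀ e ∈ F.E,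
        (∀ x ∈ e, x ∈ F.outSet (a * M ^ (m + 16)) (a * M ^ (m + 16 + g))) → (e ∈ ω₁ ↔ e ∈ ω₂)) →
          (ω₁ ∈ Fo' ↔ ω₂ ∈ Fo')) →
      (∀ v : V, v ∈ F.good → F.rad v < a * M ^ (m + 16 + g) → v ∈ Wo) →
      (∀ v : V, v ∈ F.good → F.rad v < a * M ^ (m + 16 + g) → v ∈ Wo') →
      R ⊆ Wo ∩ F.outSet (a * M ^ (m + 16)) (a * M ^ (m + 16 + g)) →
      Rq ⊆ Wo' ∩ F.outSet (a * M ^ (m + 16)) (a * M ^ (m + 16 + g)) →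
      let P := rcMeasure (fromEdgeSet (↑F.E : Set (Sym2 V))) p q ∅
      let Fd : Set V → Set V → Set (BondConfig V) := fun U₀ R₀ =>
        {ω | ω ∩ (↑F.E : Set (Sym2 V)) ∈ explEvent (F.inSet a) (F.annSet a (a * M ^ m)) U₀ R₀ ∩
          {ω | ∀ r ∈ R₀, ∀ r₂ ∈ R₀, ∃ v ∈ U₀ \ F.inSet a, ∃ v' ∈ U₀ \ F.inSet a,
            s(v, r) ∈ ω ∧ s(v', r₂) ∈ ω ∧ ω ∈ openConnIn (U₀ \ F.inSet a) v v'}}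
      let N : Set (BondConfig V) → Set V → Set V → Set V → Set V → ℝ := fun Fo₀ Wo₀ R₀ U₀ R₀' =>
        P.real (Fo₀ ∩ Fd U₀ R₀' ∩ openCrossing (Wo₀ \ U₀) R₀' R₀)
      N Fo Wo R U' R' * N Fo' Wo' Rq U'' R'' ≤
        q ^ 8 / c ^ 20 * (N Fo Wo R U'' R'' * N Fo' Wo' Rq U' R')) :
    ∀ {V : Type u} [Fintype V] [DecidableEq V] (F : ScaleFrame V) {p q c a M : ℝ} {m g L : ℕ},
      p ∈ Set.Ico (0 : ℝ) 1 → 1 ≤ q → 0 < c → c ≤ 1 → 0 < a → 4 ≤ M → 2 ≤ m → 1 ≤ g → 1 ≤ L →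
      (1 - c) ^ (m / 2) < 1 →
      a * M ^ (L * (m + 17 + g) + m + 1) ≤ F.Rmax → F.η ≤ a →
      F.LadderRSWb p q c a M (L * (m + 17 + g) + m + 1) 13 →
    ∀ (x x' : V),
      (∃ w : (fromEdgeSet (↑F.E : Set (Sym2 V))).Walk x x',
        ∀ z ∈ w.support, z ∈ F.good ∧ F.rad z < a - F.η) →
    ∀ (Q : ℕ → ℝ),
      q ^ 8 / c ^ 20 / (1 - (1 - c) ^ (m / 2)) ^ 2 ≤ Q 1 →
      (∀ l : ℕ, 1 ≤ l → l < L →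
        (1 / (q ^ 8 / c ^ 20) + (1 - 1 / (q ^ 8 / c ^ 20)) * Q l) / (1 - (1 - c) ^ (m / 2)) ^ 2 ≤
          Q (l + 1)) →
      let P := rcMeasure (fromEdgeSet (↑F.E : Set (Sym2 V))) p q ∅
      let aL : ℝ := a * M ^ (L * (m + 17 + g))
      let Fd : Set V → Set V → Set (BondConfig V) := fun U R => {ω | ω ∩ (↑F.E : Set (Sym2 V)) ∈
        explEvent (F.inSet aL) (F.annSet aL (aL * M ^ m)) U R ∩
          {ω | ∀ r ∈ R, ∀ r₂ ∈ R, ∃ v ∈ U \ F.inSet aL, ∃ v' ∈ U \ F.inSet aL,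
            s(v, r) ∈ ω ∧ s(v', r₂) ∈ ω ∧ ω ∈ openConnIn (U \ F.inSet aL) v v'}}
      let InP : V → Set V → Set V → Set (BondConfig V) := fun y U R =>
        {ω | ∃ w ∈ R, ∃ v ∈ U, ω ∩ (↑F.E : Set (Sym2 V)) ∈ openConnIn U y v ∧
          s(v, w) ∈ ω ∩ (↑F.E : Set (Sym2 V))}
      let u : V → Set V → Set V → ℝ := fun y U R => P.real (Fd U R ∩ InP y U R) / P.real (Fd U R)
      ∀ (U R U₂ R₂ : Set V), 0 < u x U R → 0 < u x U₂ R₂ →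
        u x U R * u x' U₂ R₂ ≤ Q L * (u x' U R * u x U₂ R₂) := by
  intro V _ _ F p q c a M m g L hp hq hc hc1 ha hM hm hg hL1 hε1 hRmax hηa hL x x' hxx' Q hQ1 hQ
    P aL Fd InP u U R U₂ R₂ hu1 hu2
  classical
  -- the generic-level objects; restate the goal and the positivity hypotheses through them
  set FdAt : ℝ → Set V → Set V → Set (BondConfig V) := fun b₀ U R =>
    {ω | ω ∩ (↑F.E : Set (Sym2 V)) ∈ explEvent (F.inSet b₀) (F.annSet b₀ (b₀ * M ^ m)) U R ∩
      {ω | ∀ r ∈ R, ∀ r₂ ∈ R, ∃ v ∈ U \ F.inSet b₀, ∃ v' ∈ U \ F.inSet b₀,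
        s(v, r) ∈ ω ∧ s(v', r₂) ∈ ω ∧ ω ∈ openConnIn (U \ F.inSet b₀) v v'}} with hFdAt
  set uAt : ℝ → V → Set V → Set V → ℝ := fun b₀ y U R =>
    P.real (FdAt b₀ U R ∩ InP y U R) / P.real (FdAt b₀ U R) with huAt
  set Dsp : ℕ := m + 17 + g with hDsp
  set al : ℕ → ℝ := fun l => a * M ^ (l * Dsp) with hal
  have hu1' : 0 < uAt (al L) x U R := hu1
  have hu2' : 0 < uAt (al L) x U₂ R₂ := hu2
  suffices hfin : uAt (al L) x U R * uAt (al L) x' U₂ R₂ ≤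
      Q L * (uAt (al L) x' U R * uAt (al L) x U₂ R₂) by exact hfin
  clear hu1 hu2 u Fd
  obtain ⟨W, hW⟩ := hxx'
  have hp' : p ∈ Set.Icc (0 : ℝ) 1 := ⟨hp.1, hp.2.le⟩
  have hq0 : 0 < q := one_pos.trans_le hq
  have hm1 : 1 ≤ m := by omega
  have hη0 := F.η_pos
  haveI : IsProbabilityMeasure P := isProbabilityMeasure_rcMeasure _ hp' hq0 ∅
  -- the constants of the scheme
  set K : ℝ := q ^ 8 / c ^ 20 with hK
  set ε : ℝ := (1 - c) ^ (m / 2) with hε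
  have hK1 : 1 ≤ K := by
    rw [hK, le_div_iff₀ (pow_pos hc 20), one_mul]
    exact (pow_le_one₀ hc.le hc1).trans (one_le_pow₀ hq)
  have hε0 : 0 ≤ ε := pow_nonneg (sub_nonneg.2 hc1) _
  -- the levels
  have hM1 : (1 : ℝ) ≤ M := by linarith only [hM]
  have hal0 : ∀ l, a ≤ al l := fun l => le_mul_of_one_le_right ha.le (one_le_pow₀ hM1)
  have halpos : ∀ l, 0 < al l := fun l => ha.trans_le (hal0 l)
  have hηl : ∀ l, F.η ≤ al l := fun l => hηa.trans (hal0 l)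
  have hal_succ : ∀ l, al (l + 1) = al l * M ^ (m + 17 + g) := fun l => by
    simp only [hal, hDsp, Nat.succ_mul, pow_add, mul_assoc]
  have hRl : ∀ l, l + 1 ≤ L → al (l + 1) * M ^ (m + 1) ≤ F.Rmax := fun l hl => by
    have h1 : al (l + 1) * M ^ (m + 1) = a * M ^ ((l + 1) * Dsp + (m + 1)) := by
      simp only [hal, pow_add, mul_assoc]
    rw [h1]
    refine (scale_mono ha hM ?_).trans hRmax
    have h2 := Nat.mul_le_mul_right Dsp hl
    omega
  have hRlm : ∀ l, l ≤ L → al l * M ^ m ≤ F.Rmax := fun l hl => by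
    have h1 : al l * M ^ m = a * M ^ (l * Dsp + m) := by simp only [hal, pow_add, mul_assoc]
    rw [h1]
    refine (scale_mono ha hM ?_).trans hRmax
    have h2 := Nat.mul_le_mul_right Dsp hl
    omega
  have hLl : ∀ l, l + 1 ≤ L → F.LadderRSWb p q c (al l) M (m + 16 + g) 13 := fun l hl => by
    have h2 := Nat.mul_le_mul_right Dsp hl
    rw [Nat.succ_mul] at h2
    exact ScaleFrame.LadderRSWb.mono F (ScaleFrame.LadderRSWb.shift F hL (l * Dsp) (by omega))
      (by omega)
  have hsepl : ∀ l, l + 1 ≤ L → ∀ i : ℕ, i + 1 ≤ m →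
      F.SepBound p q c (al l * M ^ i) (al l * M ^ (i + 1)) := fun l hl i hi =>
    ScaleFrame.LadderRSWb.sepBound F (hLl l hl) (by norm_num) (by omega)
  -- the anchors lie deep inside every level
  have hwalk : ∀ l, ∃ w : (fromEdgeSet (↑F.E : Set (Sym2 V))).Walk x x',
      ∀ z ∈ w.support, z ∈ F.good ∧ F.rad z < al l - F.η := fun l =>
    ⟨W, fun z hz => ⟨(hW z hz).1, by linarith only [(hW z hz).2, hal0 l]⟩⟩
  have hwalk' : ∀ l, ∃ w : (fromEdgeSet (↑F.E : Set (Sym2 V))).Walk x' x,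
      ∀ z ∈ w.support, z ∈ F.good ∧ F.rad z < al l - F.η := fun l =>
    ⟨W.reverse, fun z hz => by
      rw [Walk.support_reverse, List.mem_reverse] at hz
      exact ⟨(hW z hz).1, by linarith only [(hW z hz).2, hal0 l]⟩⟩
  have hxl : ∀ l, x ∈ F.inSet (al l) := fun l =>
    ⟨(hW x W.start_mem_support).1, by
      linarith only [(hW x W.start_mem_support).2, hal0 l, F.η_pos]⟩
  have hx'l : ∀ l, x' ∈ F.inSet (al l) := fun l =>
    ⟨(hW x' W.end_mem_support).1, by
      linarith only [(hW x' W.end_mem_support).2, hal0 l, F.η_pos]⟩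
  -- the objects of the scheme
  set NAt : ℕ → Finset V × Finset V → Finset V × Finset V → ℝ := fun l C D =>
    P.real (FdAt (al (l + 1)) ↑C.1 ↑C.2 ∩ FdAt (al l) ↑D.1 ↑D.2 ∩
      openCrossing ((↑C.1 ∪ ↑C.2) \ ↑D.1) ↑D.2 ↑C.2) with hNAt
  set MAt : ℕ → Finset V × Finset V → Finset V × Finset V → ℝ := fun l C D =>
    NAt l C D / P.real (FdAt (al (l + 1)) ↑C.1 ↑C.2) with hMAt
  set UU : ℕ → Finset V × Finset V → ℝ := fun l D => uAt (al l) x ↑D.1 ↑D.2 with hUU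
  set UU' : ℕ → Finset V × Finset V → ℝ := fun l D => uAt (al l) x' ↑D.1 ↑D.2 with hUU'
  set s : ℕ → Finset (Finset V × Finset V) := fun l =>
    Finset.univ.filter fun D => 0 < UU l D ∧ (l < L → ∃ C, 0 < NAt l C D) with hs
  have hmem_s : ∀ l D, D ∈ s l ↔ 0 < UU l D ∧ (l < L → ∃ C, 0 < NAt l C D) := fun l D => by
    simp only [hs, Finset.mem_filter, Finset.mem_univ, true_and]
  have hNnn : ∀ l C D, 0 ≤ NAt l C D := fun l C D => measureReal_nonneg
  have hunn : ∀ b₀ y U R, 0 ≤ uAt b₀ y U R := fun b₀ y U R =>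
    div_nonneg measureReal_nonneg measureReal_nonneg
  have hupos : ∀ (b₀ : ℝ) (y : V) (U R : Set V),
      0 < uAt b₀ y U R ↔ 0 < P.real (FdAt b₀ U R ∩ InP y U R) := by
    intro b₀ y U R
    constructor
    · intro h
      rcases (measureReal_nonneg (μ := P) (s := FdAt b₀ U R ∩ InP y U R)).eq_or_lt with h0 | h0
      · have h1 : uAt b₀ y U R = 0 := by simp only [huAt, ← h0, zero_div]
        rw [h1] at h
        exact absurd h (lt_irrefl 0)
      · exact h0
    · intro h
      exact div_pos h (h.trans_le (measureReal_mono Set.inter_subset_left))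
  -- (P1) base-walk surgery: `u_{x'} > 0 ⇔ u_x > 0`
  have hP1 : ∀ l, l ≤ L → ∀ (U R : Set V), (0 < uAt (al l) x U R ↔ 0 < uAt (al l) x' U R) := by
    intro l hl U R
    rw [hupos, hupos]
    exact ⟨F.insidePiece_pos_of_walk (fromEdgeSet (↑F.E : Set (Sym2 V))) rfl hp hq0 (halpos l) hM
        hm1 (hηl l) (hRlm l hl) (hwalk l) U R,
      F.insidePiece_pos_of_walk (fromEdgeSet (↑F.E : Set (Sym2 V))) rfl hp hq0 (halpos l) hM
        hm1 (hηl l) (hRlm l hl) (hwalk' l) U R⟩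
  -- (CH) the squeeze of one level of the chain
  have hchain : ∀ l, l + 1 ≤ L → ∀ (C : Finset V × Finset V) (y : V), y ∈ F.inSet (al l) →
      (∑ D ∈ (Finset.univ : Finset (Finset V × Finset V)), NAt l C D * uAt (al l) y ↑D.1 ↑D.2) ≤
          P.real (FdAt (al (l + 1)) ↑C.1 ↑C.2 ∩ InP y ↑C.1 ↑C.2) ∧
        (1 - ε) * P.real (FdAt (al (l + 1)) ↑C.1 ↑C.2 ∩ InP y ↑C.1 ↑C.2) ≤
          ∑ D ∈ (Finset.univ : Finset (Finset V × Finset V)), NAt l C D * uAt (al l) y ↑D.1 ↑D.2 :=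
    fun l hl C y hy => F.chainLevel_squeeze (fromEdgeSet (↑F.E : Set (Sym2 V))) rfl hp' hq hc1
      (halpos l) hM hm1 (hal_succ l) (hRl l hl) (hηl l) (hsepl l hl) ↑C.1 ↑C.2 y hy
  -- (KEY) bounded cross-ratios of the kernel
  have hcrossN : ∀ l, l + 1 ≤ L → ∀ C C' D D' : Finset V × Finset V,
      NAt l C D * NAt l C' D' ≤ K * (NAt l C D' * NAt l C' D) := fun l hl C C' D D' =>
    ScaleFrame.kernel_crossRatio_le_of_key hKEY F hp hq hc hc1 (halpos l) hM hm1 hg (hal_succ l)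
      (hRl l hl) (hηl l) (hLl l hl) ↑C.1 ↑C.2 ↑C'.1 ↑C'.2 ↑D.1 ↑D.2 ↑D'.1 ↑D'.2
  -- (P3) separator surgery: a positive row has a positive kernel entry
  have hP3 : ∀ l, l + 1 ≤ L → ∀ C : Finset V × Finset V,
      0 < P.real (FdAt (al (l + 1)) ↑C.1 ↑C.2 ∩ InP x ↑C.1 ↑C.2) →
        ∃ D : Finset V × Finset V, 0 < NAt l C D ∧
          0 < P.real (FdAt (al l) ↑D.1 ↑D.2 ∩ InP x ↑D.1 ↑D.2) := fun l hl C hpos =>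
    F.exists_kernel_pos (fromEdgeSet (↑F.E : Set (Sym2 V))) rfl hp hq hc (halpos l) hM hm
      (hal_succ l) (hRl l hl) (hηl l) (hsepl l hl 1 (by omega)) (hxl l) ↑C.1 ↑C.2 hpos
  -- positivity of the kernel on `s (l+1) × s l`, and of the outer datum
  have hrow : ∀ l, l < L → ∀ C ∈ s (l + 1),
      0 < P.real (FdAt (al (l + 1)) ↑C.1 ↑C.2 ∩ InP x ↑C.1 ↑C.2) ∧
        0 < P.real (FdAt (al (l + 1)) ↑C.1 ↑C.2) := by
    intro l hl C hC
    have hnum := (hupos _ _ _ _).1 ((hmem_s _ _).1 hC).1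
    exact ⟨hnum, hnum.trans_le (measureReal_mono Set.inter_subset_left)⟩
  have hNpos : ∀ l, l < L → ∀ C ∈ s (l + 1), ∀ D ∈ s l, 0 < NAt l C D := by
    intro l hl C hC D hD
    obtain ⟨C', hC'⟩ := ((hmem_s _ _).1 hD).2 hl
    obtain ⟨D', hD'N, -⟩ := hP3 l hl C (hrow l hl C hC).1
    have h := hcrossN l hl C C' D' D
    by_contra hle
    have h0 : NAt l C D = 0 := le_antisymm (not_lt.1 hle) (hNnn _ _ _)
    rw [h0, zero_mul, mul_zero] at h
    exact absurd h (not_le.2 (mul_pos hD'N hC'))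
  have hMpos : ∀ l < L, ∀ C ∈ s (l + 1), ∀ D ∈ s l, 0 < MAt l C D := by
    intro l hl C hC D hD
    simp only [hMAt]
    exact div_pos (hNpos l hl C hC D hD) (hrow l hl C hC).2
  have hcrossM : ∀ l < L, ∀ C ∈ s (l + 1), ∀ C' ∈ s (l + 1), ∀ D ∈ s l, ∀ D' ∈ s l,
      MAt l C D * MAt l C' D' ≤ K * (MAt l C D' * MAt l C' D) := by
    intro l hl C _ C' _ D _ D' _
    simp only [hMAt]
    rw [div_mul_div_comm, div_mul_div_comm, ← mul_div_assoc]
    exact div_le_div_of_nonneg_right (hcrossN l hl C C' D D')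
      (mul_nonneg measureReal_nonneg measureReal_nonneg)
  -- nonemptiness of the index sets
  set D₀ : Finset V × Finset V := ((Set.toFinite U).toFinset, (Set.toFinite R).toFinset) with hD₀
  set D₂ : Finset V × Finset V := ((Set.toFinite U₂).toFinset, (Set.toFinite R₂).toFinset) with hD₂
  have hD₀s : D₀ ∈ s L := by
    rw [hmem_s]
    refine ⟨?_, fun h => absurd h (lt_irrefl L)⟩
    simp only [hUU, hD₀, Set.Finite.coe_toFinset]
    exact hu1'
  have hD₂s : D₂ ∈ s L := by
    rw [hmem_s]
    refine ⟨?_, fun h => absurd h (lt_irrefl L)⟩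
    simp only [hUU, hD₂, Set.Finite.coe_toFinset]
    exact hu2'
  have hne_step : ∀ l, l < L → (s (l + 1)).Nonempty → (s l).Nonempty := by
    rintro l hl ⟨C, hC⟩
    obtain ⟨D, hDN, hDpos⟩ := hP3 l hl C (hrow l hl C hC).1
    refine ⟨D, (hmem_s _ _).2 ⟨?_, fun _ => ⟨C, hDN⟩⟩⟩
    simp only [hUU]
    exact (hupos _ _ _ _).2 hDpos
  have hne : ∀ k, k ≤ L → (s (L - k)).Nonempty := by
    intro k
    induction k with
    | zero => exact fun _ => ⟨D₀, hD₀s⟩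
    | succ k ih =>
      intro hk
      have h := hne_step (L - (k + 1)) (by omega) (by
        rw [show L - (k + 1) + 1 = L - k by omega]
        exact ih (by omega))
      exact h
  have hne' : ∀ l ≤ L, (s l).Nonempty := fun l hl => by
    have h := hne (L - l) (by omega)
    rwa [Nat.sub_sub_self hl] at h
  -- the two-sided squeezes, with the sums restricted to the index sets
  have hvanish : ∀ y : V, (y = x ∨ y = x') → ∀ l, l ≤ L → ∀ D : Finset V × Finset V,
      D ∉ s l → ∀ C : Finset V × Finset V, NAt l C D * uAt (al l) y ↑D.1 ↑D.2 = 0 := by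
    intro y hy l hl D hD C
    rw [hmem_s, not_and_or] at hD
    rcases hD with hD | hD
    · have hux : uAt (al l) x ↑D.1 ↑D.2 = 0 :=
        le_antisymm (not_lt.1 (by simpa only [hUU] using hD)) (hunn _ _ _ _)
      have huy : uAt (al l) y ↑D.1 ↑D.2 = 0 := by
        rcases hy with hy | hy
        · rw [hy]
          exact hux
        · rw [hy]
          by_contra hne0
          have hpos : 0 < uAt (al l) x' ↑D.1 ↑D.2 := lt_of_le_of_ne (hunn _ _ _ _) (Ne.symm hne0)
          exact absurd hux ((hP1 l hl _ _).2 hpos).ne'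
      rw [huy, mul_zero]
    · rw [Classical.not_imp, not_exists] at hD
      have h0 : NAt l C D = 0 := le_antisymm (not_lt.1 (hD.2 C)) (hNnn _ _ _)
      rw [h0, zero_mul]
  have hUgen : ∀ y : V, (y = x ∨ y = x') → (∀ l, y ∈ F.inSet (al l)) →
      ∀ l < L, ∀ C ∈ s (l + 1),
        (∑ D ∈ s l, MAt l C D * uAt (al l) y ↑D.1 ↑D.2) ≤ uAt (al (l + 1)) y ↑C.1 ↑C.2 ∧
          (1 - ε) * uAt (al (l + 1)) y ↑C.1 ↑C.2 ≤ ∑ D ∈ s l, MAt l C D * uAt (al l) y ↑D.1 ↑D.2 := by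
    intro y hy hyl l hl C hC
    obtain ⟨-, hPC⟩ := hrow l hl C hC
    obtain ⟨h1, h2⟩ := hchain l hl C y (hyl l)
    have hsum : (∑ D ∈ s l, MAt l C D * uAt (al l) y ↑D.1 ↑D.2) =
        (∑ D ∈ (Finset.univ : Finset (Finset V × Finset V)), NAt l C D * uAt (al l) y ↑D.1 ↑D.2) /
          P.real (FdAt (al (l + 1)) ↑C.1 ↑C.2) := by
      rw [Finset.sum_div]
      rw [← Finset.sum_subset (Finset.subset_univ (s l)) fun D _ hD => by
        rw [hvanish y hy l hl.le D hD C, zero_div]]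
      refine Finset.sum_congr rfl fun D _ => ?_
      simp only [hMAt]
      rw [div_mul_eq_mul_div]
    have huC : uAt (al (l + 1)) y ↑C.1 ↑C.2 =
        P.real (FdAt (al (l + 1)) ↑C.1 ↑C.2 ∩ InP y ↑C.1 ↑C.2) /
          P.real (FdAt (al (l + 1)) ↑C.1 ↑C.2) := by simp only [huAt]
    rw [hsum, huC]
    refine ⟨div_le_div_of_nonneg_right h1 hPC.le, ?_⟩
    rw [← mul_div_assoc]
    exact div_le_div_of_nonneg_right h2 hPC.le
  have hU : ∀ l < L, ∀ C ∈ s (l + 1),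
      (∑ D ∈ s l, MAt l C D * UU l D) ≤ UU (l + 1) C ∧
        (1 - ε) * UU (l + 1) C ≤ ∑ D ∈ s l, MAt l C D * UU l D :=
    hUgen x (Or.inl rfl) hxl
  have hU' : ∀ l < L, ∀ C ∈ s (l + 1),
      (∑ D ∈ s l, MAt l C D * UU' l D) ≤ UU' (l + 1) C ∧
        (1 - ε) * UU' (l + 1) C ≤ ∑ D ∈ s l, MAt l C D * UU' l D :=
    hUgen x' (Or.inr rfl) hx'l
  have hU0 : ∀ D ∈ s 0, 0 < UU 0 D := fun D hD => ((hmem_s _ _).1 hD).1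
  have hU0' : ∀ D ∈ s 0, 0 < UU' 0 D := fun D hD =>
    (hP1 0 (Nat.zero_le L) _ _).1 ((hmem_s _ _).1 hD).1
  -- Kesten's multilevel scheme
  have key := Literature.Analysis.Convexity.Doeblin.kesten_multilevel_osc_le s MAt UU UU' Q L hK1
    hε0 hε1 hne' hMpos hcrossM hU0 hU0' hU hU' hQ1 hQ L hL1 le_rfl D₀ hD₀s D₂ hD₂s
  -- clear denominators
  have hA : 0 < UU L D₀ := ((hmem_s _ _).1 hD₀s).1
  have hC' : 0 < UU L D₂ := ((hmem_s _ _).1 hD₂s).1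
  have hB : 0 < UU' L D₀ := (hP1 L le_rfl _ _).1 hA
  have hD' : 0 < UU' L D₂ := (hP1 L le_rfl _ _).1 hC'
  rw [div_div_div_eq, div_le_iff₀ (mul_pos hB hC')] at key
  simp only [hUU, hUU', hD₀, hD₂, Set.Finite.coe_toFinset] at key
  exact key

end Literature.Probability.LatticeModels
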